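/-
Copyright (c) 2026 the pub-hodgecm-mathlib formalisation cell (harness21).  Prover seat hodgecm-mathlib-K2E1-p12 (g6), Track B ∕ K2-LIT, h413 = `stmt-HodgeConjecture-24833`,
R90-TF section S8 «ContSpec-n½», ESTATE T (S8 dealer R90-CS-plan (g3) S8-R221 (3) «`R90S8ResGMidRowsOfTauExportsClosedU3`: instantiate ★ p864446 with ★ p864481 OfPorts + ★ §5∕§6»), FILE A:
the PURE-TYPE BINDERS of ★ `chiEisenstein_meromorphic_exports_kfinite_of_ports_of_coweightLine` (K2E1-p15) DISCHARGED for a ★ §5d pure block — the internal `W`-isotypy `hVτ`, the archimedean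
left law `cB`∕`hVB` with its `z`-free restriction `χM` to `M_∞`, and the open-compact `GL₃(𝔸_f)`-level `U₀′` with `hVU`.
-/
import Summits.HodgeConjecture.HodgeConjecture.Theorems.R90S8ResGMidAtomTauPureSplitU3      -- ★ p864443 (this seat) §5; brings ★ laws, ★ τ-DEFS, ★ β2, ★ (3′), ★ GKModulesProofs, `submodule_le_of_isIrreducible`
import Summits.HodgeConjecture.HodgeConjecture.Theorems.K2E1HeightFunctionU3              -- ★ `borelHeight_one`
import Literature.NumberTheory.Automorphic.UnitaryGroupCuspIntegralSiegelMajorant           -- ★ `borelHeight_mul_of_mem_comap_standardMaximalCompactGL`; brings ★ `borelHeight_borel_mul`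
import Literature.NumberTheory.Automorphic.UnitaryGroupCongruenceSubgroupLevels             -- ★ `exists_finCongruenceLevel_span_le_of_isOpen`
import Literature.NumberTheory.Automorphic.AshSmithTheoryHeckeLevelProofs                  -- ★ `isOpen∕isCompact_comap_ofFinite_principalCongruenceLevel`, `comap_ofFinite_principalCongruenceLevel_le`
import HarnessLib

/-!
# R90-TF · S8 «ContSpec-n½» — `R90S8ResGMidPureBlockPortBindersU3`: THE PURE-TYPE BINDERS OF THE K-FINITE EXPORTS HEAD (★ p864481 `…_of_ports_of_coweightLine`) AT A ★ §5d PURE BLOCK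

Cell `hodgecm-mathlib`, crux H413 (`stmt-HodgeConjecture-24833`, lane `--supports … --as helper`), route of record `HCCMUnconditional`; R90-TF section S8, ESTATE T, deal S8-R221 (3) (FILE A of
two; FILE B `R90S8ResGMidRowsOfTauExportsClosedU3` composes).  THEOREMS ONLY (no `def`, no `instance`, no `notation`, no named-fact hypothesis, no `sorry`; default heartbeats); measure-free;
count-neutral; CLOSES NO SOCKET.

★ p864481's head over a pure-type K-finite block `V` keeps visible, besides the T-head block binders (`FiniteDimensional`, `hVK hVχ hVc hVM` — delivered by ★ §5d), the PURE-TYPE data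
`(W, τ : G_∞ → End W, cB, hVB, hVτ, χM, hcBM, hco)` and the `GL₃(𝔸_f)`-level `(U₀′, hU₀o, hU₀c, hU₀K, hVU)`.  For a ★ §5d block — finite-dimensional, `K_max`-stable, `K_max`-IRREDUCIBLE,
continuous bounded `(χ₁, χ₂)`-pair-sections at a τ-level `(tauLevel U₀, 1)` — this file discharges all of them except the CO-WEIGHT LINE `hco` (the (α)-instantiation at the archimedean
group of record, left to FILE B as the visible letter `hCO`):
* §A1 **`exists_isotypy_of_kMax_irreducible`** — THE INTERNAL `W`-ISOTYPY: a minimal `K_∞`-stable `W₀ ≤ V` (irreducible `K_∞`-type `τ₀ := r|_{W₀}`) with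
  `V ≤ ⨆ {range J | J : W₀ →ₗ (G(𝔸) → ℂ), range J ≤ V, J(v)(x·ι k) = J(τ k v)(x) on ι⁻¹K}` for the function `τ k := τ₀ ⟨ι k, _⟩` (junk `id` off `ι⁻¹K`) — ★ §5a's mechanism («an irreducible of
  `K_∞ × K_f⁰` is `K_∞`-isotypic»: the `τ₀`-part of `V` is `K_max`-stable because `r(ι_f c)|_V` is a `K_∞`-intertwiner, and non-zero, so ★ `submodule_le_of_isIrreducible` gives all of `V`),
  read INTERNALLY (`homRangeSum (r|_V ∘ K_∞) τ₀` pushed along `V ↪`, `Submodule.map_iSup`) — exactly p15's `hVτ`.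
* §A2 **THE ARCHIMEDEAN LEFT LAW**: `borelHeight_archBorel_mul` (`H(ι b·g) = H(ι b)·H(g)`, ★ `borelHeight_borel_mul` + ★ `borelHeight_one`), `borelHeight_archToAdelic_eq_one` (`H(ι m) = 1` on
  `ι⁻¹K`, ★ `borelHeight_mul_of_mem_comap_standardMaximalCompactGL`), **`flatSectionU_archBorel_mul`** (`f_z^φ(ι(ba)·x_f) = [χ₁χ₂](ι b)·H(ι b)^z · f_z^φ(ι a·x_f)`, pair-section law +
  `Complex.mul_cpow_ofReal_nonneg`), and **`exists_archBorelLaw`**: ONE `cB : ℂ → G_∞ → ℂ` with p15's `hVB` for every space of `(χ₁, χ₂)`-pair-sections, `z`-FREE on `M_∞ = B_∞ ∩ K_∞`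
  (`hcBM` with `χM := cB 0`) and there equal to `[χ₁χ₂](ι m)` — the character the co-weight line is about.
* §A3 **THE `GL₃(𝔸_f)`-LEVEL**: **`exists_GLlevel_of_isTauLevel`** — every τ-level `U₀` dominates a principal `K_f(n𝓞_L) = ofFinite⁻¹K(n𝓞_L) ≤ GL₃(𝔸_{L,f})` (open, compact, `≤ GL₃(𝒪̂_L)`: ★
  `AshSmithTheoryHeckeLevelProofs`; ★ `exists_finCongruenceLevel_span_le_of_isOpen`) whose unitary points lie in `U₀`; **`hVU_of_le_tauLevel`** — p15's `hVU` for any `V ≤ V(…; tauLevel U₀, 1)`.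
HONEST LABEL: HC_CM is proved only modulo the 7 printed citations (2 remaining named inputs: hLiu418 = `stmt-HodgeConjecture-24832`, h413 = `stmt-HodgeConjecture-24833`) until rung 0
closes; binders pay no socket; the co-weight line (α at `K_∞`) is NOT claimed; REL ≠ ★ ≠ WRITTEN ≠ BUILT; count-neutral.

## References
* [BrockerTomDieck1985] T. Bröcker, T. tom Dieck, *Representations of Compact Lie Groups*, GTM 98 (1985), II (4.14) (irreducibles of products are isotypic per factor).
* [WallachRRG1] N. R. Wallach, *Real Reductive Groups I* (1988), §1.4.7 (`V(γ)`), §3.3.1.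
* [Garrett2018] P. Garrett, *Modern Analysis of Automorphic Forms by Example* (2018), §2.2 (height under the Borel and the maximal compact).
* [BorelJacquet1979] A. Borel, H. Jacquet, *Automorphic forms and automorphic representations*, Proc. Symp. Pure Math. 33.1 (1979), §4.1 (levels `K_f(𝔫)`).
* [MoeglinWaldspurger1995] C. Mœglin, J.-L. Waldspurger, *Spectral Decomposition and Eisenstein Series* (1995), I.2.17, II.1.5.
-/

set_option autoImplicit false
set_option linter.dupNamespace false  -- the mandated namespace `…HodgeConjecture.HodgeConjecture.R90.S8` (LEAD #1 L1) repeats the summit's segment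

noncomputable section

open MeasureTheory Measure Set Filter Topology NumberField IsDedekindDomain ContRepresentation
open Literature.NumberTheory Literature.NumberTheory.Automorphic Literature.NumberTheory.Automorphic.UnitaryGroup Literature.NumberTheory.GaloisRepresentations AdelicGroupData
open Literature.NumberTheory.Automorphic.Arthur2013.Leaves.TECR Literature.NumberTheory.Rogawski1990
open Summit.HodgeConjecture.HodgeConjecture.Cruxes.H413.K2E1BorelEisensteinU
open Summit.HodgeConjecture.HodgeConjecture.Cruxes.H413.K2E1CharacterEisensteinU2Defs
open Summit.HodgeConjecture.HodgeConjecture.Cruxes.H413.K2E1CharacterEisensteinU3PairDefs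
open Summit.HodgeConjecture.HodgeConjecture.Cruxes.H413.K2E1ChiSectionSpaceU3PairDefs
open Summit.HodgeConjecture.HodgeConjecture.Cruxes.H413.K2E1HeightFunctionU3 (borelHeight_one)
open scoped ENNReal NNReal

namespace Summit.HodgeConjecture.HodgeConjecture.R90.S8

variable (L : Type) [Field L] [NumberField L] [IsCMField L]

/-! ## §A1 The internal `W`-isotypy of a `K_max`-irreducible block (p15's `hVτ`) -/

set_option maxHeartbeats 400000 in
/-- **§A1 (core) — `exists_le_map_tauPart_of_kMax_irreducible`**: for a finite-dimensional `K_max`-stable `U` on which `r(K_max)` is irreducible (`hUinf` = its `K_∞`-stability, i.e. `hU`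
restricted along `ι(K_∞) ≤ K_max`), there is a minimal `K_∞`-stable `W₀ ≤ U` — an irreducible finite-dimensional `K_∞`-type `τ₀ := r|_{W₀}` — with `U ≤ (τ₀-part of r|_U).map U.subtype`:
★ §5a's mechanism (the `τ₀`-part is `K_∞`-stable and `ι_f(G(𝒪̂)_f)`-stable — `r(ι_f c)|_U` is a `K_∞`-intertwiner —, non-zero, hence all of the irreducible `U` by ★ `submodule_le_of_isIrreducible`).
[cite: BrockerTomDieck1985, II (4.14)] [cite: WallachRRG1, §1.4.7, §3.3.1] -/
theorem exists_le_map_tauPart_of_kMax_irreducible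
    (U : Submodule ℂ ((quasiSplit (↥(maximalRealSubfield L)) L (IsCMField.complexConj L) 3).Adelic → ℂ)) (hU : ∀ k : ↥((standardMaximalCompactGL 3 L).comap (adelicVal (↥(maximalRealSubfield L)) L (IsCMField.complexConj L) 3 ((StdForm.antidiagonal 3).over L)) : Subgroup (quasiSplit (↥(maximalRealSubfield L)) L (IsCMField.complexConj L) 3).Adelic), ∀ ψ ∈ U, ((rightTranslation (quasiSplit (↥(maximalRealSubfield L)) L (IsCMField.complexConj L) 3)).comp ((standardMaximalCompactGL 3 L).comap (adelicVal (↥(maximalRealSubfield L)) L (IsCMField.complexConj L) 3 ((StdForm.antidiagonal 3).over L)) : Subgroup (quasiSplit (↥(maximalRealSubfield L)) L (IsCMField.complexConj L) 3).Adelic).subtype) k ψ ∈ U) (hUinf : ∀ k : ↥(archMaximalCompact L), ∀ ψ ∈ U, ((rightTranslation (quasiSplit (↥(maximalRealSubfield L)) L (IsCMField.complexConj L) 3)).comp (archMaximalCompact L).subtype) k ψ ∈ U)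
    [hUfd : FiniteDimensional ℂ ↥U] (hirr : (Subrepresentation.toRepresentation (⟨U, hU⟩ : Subrepresentation ((rightTranslation (quasiSplit (↥(maximalRealSubfield L)) L (IsCMField.complexConj L) 3)).comp ((standardMaximalCompactGL 3 L).comap (adelicVal (↥(maximalRealSubfield L)) L (IsCMField.complexConj L) 3 ((StdForm.antidiagonal 3).over L)) : Subgroup (quasiSplit (↥(maximalRealSubfield L)) L (IsCMField.complexConj L) 3).Adelic).subtype))).IsIrreducible) :
    ∃ (W₀ : Submodule ℂ ((quasiSplit (↥(maximalRealSubfield L)) L (IsCMField.complexConj L) 3).Adelic → ℂ)) (hW₀K : ∀ k : ↥(archMaximalCompact L), ∀ ψ ∈ W₀, ((rightTranslation (quasiSplit (↥(maximalRealSubfield L)) L (IsCMField.complexConj L) 3)).comp (archMaximalCompact L).subtype) k ψ ∈ W₀),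
      W₀ ≤ U ∧ FiniteDimensional ℂ ↥W₀ ∧ (Subrepresentation.toRepresentation (⟨W₀, hW₀K⟩ : Subrepresentation ((rightTranslation (quasiSplit (↥(maximalRealSubfield L)) L (IsCMField.complexConj L) 3)).comp (archMaximalCompact L).subtype))).IsIrreducible ∧ U ≤ (Representation.homRangeSum (Subrepresentation.toRepresentation (⟨U, hUinf⟩ : Subrepresentation ((rightTranslation (quasiSplit (↥(maximalRealSubfield L)) L (IsCMField.complexConj L) 3)).comp (archMaximalCompact L).subtype))) (Subrepresentation.toRepresentation (⟨W₀, hW₀K⟩ : Subrepresentation ((rightTranslation (quasiSplit (↥(maximalRealSubfield L)) L (IsCMField.complexConj L) 3)).comp (archMaximalCompact L).subtype)))).map U.subtype := by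
  -- `U ≠ ⊥` (an irreducible representation space is non-trivial)
  have hU0 : U ≠ ⊥ := by
    haveI := hirr
    obtain ⟨P, Q, hPQ⟩ := exists_pair_ne (Subrepresentation (Subrepresentation.toRepresentation (⟨U, hU⟩ : Subrepresentation ((rightTranslation (quasiSplit (↥(maximalRealSubfield L)) L (IsCMField.complexConj L) 3)).comp ((standardMaximalCompactGL 3 L).comap (adelicVal (↥(maximalRealSubfield L)) L (IsCMField.complexConj L) 3 ((StdForm.antidiagonal 3).over L)) : Subgroup (quasiSplit (↥(maximalRealSubfield L)) L (IsCMField.complexConj L) 3).Adelic).subtype))))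
    have hnt : Nontrivial (Submodule ℂ ↥U) := ⟨⟨P.toSubmodule, Q.toSubmodule, fun h => hPQ (Subrepresentation.toSubmodule_injective h)⟩⟩
    exact Submodule.nontrivial_iff_ne_bot.1 ((Submodule.nontrivial_iff ℂ).1 hnt)
  -- a minimal non-zero `K_∞`-stable `W₀ ≤ U`; it is irreducible
  obtain ⟨W₀, hW₀U, hW₀ne, hW₀K, hW₀min⟩ := Literature.NumberTheory.Automorphic.exists_minimal_stable_submodule ((rightTranslation (quasiSplit (↥(maximalRealSubfield L)) L (IsCMField.complexConj L) 3)).comp (archMaximalCompact L).subtype) U hU0 hUinf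
  haveI hW₀fd : FiniteDimensional ℂ ↥W₀ := Submodule.finiteDimensional_of_le hW₀U
  haveI : Nontrivial ↥W₀ := Submodule.nontrivial_iff_ne_bot.2 hW₀ne
  have hirr₀ : (Subrepresentation.toRepresentation (⟨W₀, hW₀K⟩ : Subrepresentation ((rightTranslation (quasiSplit (↥(maximalRealSubfield L)) L (IsCMField.complexConj L) 3)).comp (archMaximalCompact L).subtype))).IsIrreducible := by
    refine Literature.NumberTheory.Automorphic.isIrreducible_of_intertwiningMap_injective ((rightTranslation (quasiSplit (↥(maximalRealSubfield L)) L (IsCMField.complexConj L) 3)).comp (archMaximalCompact L).subtype)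
      ({ toLinearMap := W₀.subtype, isIntertwining' := fun k => rfl } : (Subrepresentation.toRepresentation (⟨W₀, hW₀K⟩ : Subrepresentation ((rightTranslation (quasiSplit (↥(maximalRealSubfield L)) L (IsCMField.complexConj L) 3)).comp (archMaximalCompact L).subtype))).IntertwiningMap ((rightTranslation (quasiSplit (↥(maximalRealSubfield L)) L (IsCMField.complexConj L) 3)).comp (archMaximalCompact L).subtype)) Subtype.val_injective fun U' hU' hU'le => ?_
    have hr : LinearMap.range W₀.subtype = W₀ := Submodule.range_subtype W₀
    change U' ≤ LinearMap.range W₀.subtype at hU'le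
    change U' = ⊥ ∨ U' = LinearMap.range W₀.subtype
    rw [hr] at hU'le ⊢
    exact hW₀min U' hU' hU'le
  -- `W₀ ↪ U` is a `K_∞`-map `τ → r|_U`; the `τ`-part `T` of `U`, pushed into `G(𝔸) → ℂ`, is `D := T.map U.subtype ∋ W₀`
  let j : (Subrepresentation.toRepresentation (⟨W₀, hW₀K⟩ : Subrepresentation ((rightTranslation (quasiSplit (↥(maximalRealSubfield L)) L (IsCMField.complexConj L) 3)).comp (archMaximalCompact L).subtype))).IntertwiningMap (Subrepresentation.toRepresentation (⟨U, hUinf⟩ : Subrepresentation ((rightTranslation (quasiSplit (↥(maximalRealSubfield L)) L (IsCMField.complexConj L) 3)).comp (archMaximalCompact L).subtype))) :=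
    { toLinearMap := LinearMap.codRestrict U W₀.subtype fun w => hW₀U w.2
      isIntertwining' := fun k => LinearMap.ext fun w => Subtype.ext rfl }
  -- `T` is `K_max`-stable: `k = ι(a)·ι_f(c)`, `r(ι_f c)|_U` is a `K_∞`-intertwiner, `r(ι a)` preserves the `τ`-part
  have hTK : ∀ k : ↥((standardMaximalCompactGL 3 L).comap (adelicVal (↥(maximalRealSubfield L)) L (IsCMField.complexConj L) 3 ((StdForm.antidiagonal 3).over L)) : Subgroup (quasiSplit (↥(maximalRealSubfield L)) L (IsCMField.complexConj L) 3).Adelic), ∀ v ∈ Representation.homRangeSum (Subrepresentation.toRepresentation (⟨U, hUinf⟩ : Subrepresentation ((rightTranslation (quasiSplit (↥(maximalRealSubfield L)) L (IsCMField.complexConj L) 3)).comp (archMaximalCompact L).subtype))) (Subrepresentation.toRepresentation (⟨W₀, hW₀K⟩ : Subrepresentation ((rightTranslation (quasiSplit (↥(maximalRealSubfield L)) L (IsCMField.complexConj L) 3)).comp (archMaximalCompact L).subtype))), (Subrepresentation.toRepresentation (⟨U, hU⟩ : Subrepresentation ((rightTranslation (quasiSplit (↥(maximalRealSubfield L)) L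 (IsCMField.complexConj L) 3)).comp ((standardMaximalCompactGL 3 L).comap (adelicVal (↥(maximalRealSubfield L)) L (IsCMField.complexConj L) 3 ((StdForm.antidiagonal 3).over L)) : Subgroup (quasiSplit (↥(maximalRealSubfield L)) L (IsCMField.complexConj L) 3).Adelic).subtype))) k v ∈ Representation.homRangeSum (Subrepresentation.toRepresentation (⟨U, hUinf⟩ : Subrepresentation ((rightTranslation (quasiSplit (↥(maximalRealSubfield L)) L (IsCMField.complexConj L) 3)).comp (archMaximalCompact L).subtype))) (Subrepresentation.toRepresentation (⟨W₀, hW₀K⟩ : Subrepresentation ((rightTranslation (quasiSplit (↥(maximalRealSubfield L)) L (IsCMField.complexConj L) 3)).comp (archMaximalCompact L).subtype))) := by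
    intro k v hv
    obtain ⟨a, c, haK, hcK, hk_eq⟩ : ∃ (a : ↥(arch (↥(maximalRealSubfield L)) L (IsCMField.complexConj L) 3 ((StdForm.antidiagonal 3).over L))) (c : ↥(finAdelic (↥(maximalRealSubfield L)) L (IsCMField.complexConj L) 3 ((StdForm.antidiagonal 3).over L))), (adelicVal (↥(maximalRealSubfield L)) L (IsCMField.complexConj L) 3 ((StdForm.antidiagonal 3).over L)) ((archToAdelic (↥(maximalRealSubfield L)) L (IsCMField.complexConj L) 3 ((StdForm.antidiagonal 3).over L)) a) ∈ standardMaximalCompactGL 3 L ∧ c ∈ (finAdelicIntegralLevel (↥(maximalRealSubfield L)) L (IsCMField.complexConj L) 3 ((StdForm.antidiagonal 3).over L)) ∧ (k : (quasiSplit (↥(maximalRealSubfield L)) L (IsCMField.complexConj L) 3).Adelic) = (archToAdelic (↥(maximalRealSubfield L)) L (IsCMField.complexConj L) 3 ((StdForm.antidiagonal 3).over L)) a * (finAdelicToAdelic (↥(maximalRealSubfield L)) L (IsCMField.complexConj L) 3 ((StdForm.antidiagonal 3).over L)) c :=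
      ⟨_, _, adelicVal_archToAdelic_archPart_mem L k.2, finPart_mem_finAdelicIntegralLevel L k.2, (archToAdelic_mul_finAdelicToAdelic _ _ _ _ _ _).symm⟩
    let F : (Subrepresentation.toRepresentation (⟨U, hUinf⟩ : Subrepresentation ((rightTranslation (quasiSplit (↥(maximalRealSubfield L)) L (IsCMField.complexConj L) 3)).comp (archMaximalCompact L).subtype))).IntertwiningMap (Subrepresentation.toRepresentation (⟨U, hUinf⟩ : Subrepresentation ((rightTranslation (quasiSplit (↥(maximalRealSubfield L)) L (IsCMField.complexConj L) 3)).comp (archMaximalCompact L).subtype))) :=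
      { toLinearMap := (Subrepresentation.toRepresentation (⟨U, hU⟩ : Subrepresentation ((rightTranslation (quasiSplit (↥(maximalRealSubfield L)) L (IsCMField.complexConj L) 3)).comp ((standardMaximalCompactGL 3 L).comap (adelicVal (↥(maximalRealSubfield L)) L (IsCMField.complexConj L) 3 ((StdForm.antidiagonal 3).over L)) : Subgroup (quasiSplit (↥(maximalRealSubfield L)) L (IsCMField.complexConj L) 3).Adelic).subtype))) ⟨(finAdelicToAdelic (↥(maximalRealSubfield L)) L (IsCMField.complexConj L) 3 ((StdForm.antidiagonal 3).over L)) c, finAdelicToAdelic_mem_kMax L hcK⟩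
        isIntertwining' := fun k' => LinearMap.ext fun u => Subtype.ext (by
          obtain ⟨-, a', ha'⟩ := (mem_archMaximalCompact_iff L (k' : (quasiSplit (↥(maximalRealSubfield L)) L (IsCMField.complexConj L) 3).Adelic)).1 k'.2
          show (rightTranslation (quasiSplit (↥(maximalRealSubfield L)) L (IsCMField.complexConj L) 3)) ((finAdelicToAdelic (↥(maximalRealSubfield L)) L (IsCMField.complexConj L) 3 ((StdForm.antidiagonal 3).over L)) c) ((rightTranslation (quasiSplit (↥(maximalRealSubfield L)) L (IsCMField.complexConj L) 3)) (k' : (quasiSplit (↥(maximalRealSubfield L)) L (IsCMField.complexConj L) 3).Adelic) (u : (quasiSplit (↥(maximalRealSubfield L)) L (IsCMField.complexConj L) 3).Adelic → ℂ)) = (rightTranslation (quasiSplit (↥(maximalRealSubfield L)) L (IsCMField.complexConj L) 3)) (k' : (quasiSplit (↥(maximalRealSubfield L)) L (IsCMField.complexConj L) 3).Adelic) ((rightTranslation (quasiSplit (↥(maximalRealSubfield L)) L (IsCMField.complexConj L) 3)) ((finAdelicToAdelic (↥(maximalRealSubfield L)) L (IsCMField.complexConj L) 3 ((StdForm.antidiagonal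 3).over L)) c) (u : (quasiSplit (↥(maximalRealSubfield L)) L (IsCMField.complexConj L) 3).Adelic → ℂ))
          rw [← ha', rightTranslation_arch_fin_comm]) }
    have h1 : (Subrepresentation.toRepresentation (⟨U, hU⟩ : Subrepresentation ((rightTranslation (quasiSplit (↥(maximalRealSubfield L)) L (IsCMField.complexConj L) 3)).comp ((standardMaximalCompactGL 3 L).comap (adelicVal (↥(maximalRealSubfield L)) L (IsCMField.complexConj L) 3 ((StdForm.antidiagonal 3).over L)) : Subgroup (quasiSplit (↥(maximalRealSubfield L)) L (IsCMField.complexConj L) 3).Adelic).subtype))) ⟨(finAdelicToAdelic (↥(maximalRealSubfield L)) L (IsCMField.complexConj L) 3 ((StdForm.antidiagonal 3).over L)) c, finAdelicToAdelic_mem_kMax L hcK⟩ v ∈ Representation.homRangeSum (Subrepresentation.toRepresentation (⟨U, hUinf⟩ : Subrepresentation ((rightTranslation (quasiSplit (↥(maximalRealSubfield L)) L (IsCMField.complexConj L) 3)).comp (archMaximalCompact L).subtype))) (Subrepresentation.toRepresentation (⟨W₀, hW₀K⟩ : Subrepresentation ((rightTranslation (quasiSplit (↥(maximalRealSubfield L))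 L (IsCMField.complexConj L) 3)).comp (archMaximalCompact L).subtype))) :=
      Representation.map_homRangeSum_le F ⟨v, hv, rfl⟩
    have h2 := Representation.apply_mem_homRangeSum_of_mem (ρ := (Subrepresentation.toRepresentation (⟨U, hUinf⟩ : Subrepresentation ((rightTranslation (quasiSplit (↥(maximalRealSubfield L)) L (IsCMField.complexConj L) 3)).comp (archMaximalCompact L).subtype)))) (⟨(archToAdelic (↥(maximalRealSubfield L)) L (IsCMField.complexConj L) 3 ((StdForm.antidiagonal 3).over L)) a, archToAdelic_mem_archMaximalCompact L a haK⟩ : ↥(archMaximalCompact L)) h1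
    have h3 : (Subrepresentation.toRepresentation (⟨U, hU⟩ : Subrepresentation ((rightTranslation (quasiSplit (↥(maximalRealSubfield L)) L (IsCMField.complexConj L) 3)).comp ((standardMaximalCompactGL 3 L).comap (adelicVal (↥(maximalRealSubfield L)) L (IsCMField.complexConj L) 3 ((StdForm.antidiagonal 3).over L)) : Subgroup (quasiSplit (↥(maximalRealSubfield L)) L (IsCMField.complexConj L) 3).Adelic).subtype))) k v = (Subrepresentation.toRepresentation (⟨U, hUinf⟩ : Subrepresentation ((rightTranslation (quasiSplit (↥(maximalRealSubfield L)) L (IsCMField.complexConj L) 3)).comp (archMaximalCompact L).subtype))) ⟨(archToAdelic (↥(maximalRealSubfield L)) L (IsCMField.complexConj L) 3 ((StdForm.antidiagonal 3).over L)) a, archToAdelic_mem_archMaximalCompact L a haK⟩ ((Subrepresentation.toRepresentation (⟨U, hU⟩ : Subrepresentation ((rightTranslation (quasiSplit (↥(maximalRealSubfield L)) L (IsCMField.complexConj L) 3)).comp ((standardMaximalCompactGL 3 L).comap (adelicVal (↥(maximalRealSubfield L)) L (IsCMField.complexConj L) 3 ((StdForm.antidiagonal 3).over L)) : Subgroup (quasiSplit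 (↥(maximalRealSubfield L)) L (IsCMField.complexConj L) 3).Adelic).subtype))) ⟨(finAdelicToAdelic (↥(maximalRealSubfield L)) L (IsCMField.complexConj L) 3 ((StdForm.antidiagonal 3).over L)) c, finAdelicToAdelic_mem_kMax L hcK⟩ v) :=
      Subtype.ext (by
        show (rightTranslation (quasiSplit (↥(maximalRealSubfield L)) L (IsCMField.complexConj L) 3)) (k : (quasiSplit (↥(maximalRealSubfield L)) L (IsCMField.complexConj L) 3).Adelic) (v : (quasiSplit (↥(maximalRealSubfield L)) L (IsCMField.complexConj L) 3).Adelic → ℂ) = (rightTranslation (quasiSplit (↥(maximalRealSubfield L)) L (IsCMField.complexConj L) 3)) ((archToAdelic (↥(maximalRealSubfield L)) L (IsCMField.complexConj L) 3 ((StdForm.antidiagonal 3).over L)) a) ((rightTranslation (quasiSplit (↥(maximalRealSubfield L)) L (IsCMField.complexConj L) 3)) ((finAdelicToAdelic (↥(maximalRealSubfield L)) L (IsCMField.complexConj L) 3 ((StdForm.antidiagonal 3).over L)) c) (v : (quasiSplit (↥(maximalRealSubfield L)) L (IsCMField.complexConj L) 3).Adelic → ℂ))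
        rw [hk_eq, rightTranslation_mul_apply])
    rw [h3]
    exact h2
  -- `D := T.map U.subtype` is `K_max`-stable and contains a non-zero vector of the irreducible `U`, hence `U ≤ D` (★ `submodule_le_of_isIrreducible`)
  have hD : ∀ k : ↥((standardMaximalCompactGL 3 L).comap (adelicVal (↥(maximalRealSubfield L)) L (IsCMField.complexConj L) 3 ((StdForm.antidiagonal 3).over L)) : Subgroup (quasiSplit (↥(maximalRealSubfield L)) L (IsCMField.complexConj L) 3).Adelic), ∀ v ∈ (Representation.homRangeSum (Subrepresentation.toRepresentation (⟨U, hUinf⟩ : Subrepresentation ((rightTranslation (quasiSplit (↥(maximalRealSubfield L)) L (IsCMField.complexConj L) 3)).comp (archMaximalCompact L).subtype))) (Subrepresentation.toRepresentation (⟨W₀, hW₀K⟩ : Subrepresentation ((rightTranslation (quasiSplit (↥(maximalRealSubfield L)) L (IsCMField.complexConj L) 3)).comp (archMaximalCompact L).subtype)))).map U.subtype, ((rightTranslation (quasiSplit (↥(maximalRealSubfield L)) L (IsCMField.complexConj L) 3)).comp ((standardMaximalCompactGL 3 L).comap (adelicVal (↥(maximalRealSubfield L)) L (IsCMField.complexConj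 L) 3 ((StdForm.antidiagonal 3).over L)) : Subgroup (quasiSplit (↥(maximalRealSubfield L)) L (IsCMField.complexConj L) 3).Adelic).subtype) k v ∈ (Representation.homRangeSum (Subrepresentation.toRepresentation (⟨U, hUinf⟩ : Subrepresentation ((rightTranslation (quasiSplit (↥(maximalRealSubfield L)) L (IsCMField.complexConj L) 3)).comp (archMaximalCompact L).subtype))) (Subrepresentation.toRepresentation (⟨W₀, hW₀K⟩ : Subrepresentation ((rightTranslation (quasiSplit (↥(maximalRealSubfield L)) L (IsCMField.complexConj L) 3)).comp (archMaximalCompact L).subtype)))).map U.subtype := by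
    rintro k _ ⟨t, ht, rfl⟩
    exact ⟨_, hTK k t ht, rfl⟩
  obtain ⟨w, hw, hw0⟩ := (Submodule.ne_bot_iff W₀).1 hW₀ne
  have hUD : U ≤ (Representation.homRangeSum (Subrepresentation.toRepresentation (⟨U, hUinf⟩ : Subrepresentation ((rightTranslation (quasiSplit (↥(maximalRealSubfield L)) L (IsCMField.complexConj L) 3)).comp (archMaximalCompact L).subtype))) (Subrepresentation.toRepresentation (⟨W₀, hW₀K⟩ : Subrepresentation ((rightTranslation (quasiSplit (↥(maximalRealSubfield L)) L (IsCMField.complexConj L) 3)).comp (archMaximalCompact L).subtype)))).map U.subtype :=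
    submodule_le_of_isIrreducible ((rightTranslation (quasiSplit (↥(maximalRealSubfield L)) L (IsCMField.complexConj L) 3)).comp ((standardMaximalCompactGL 3 L).comap (adelicVal (↥(maximalRealSubfield L)) L (IsCMField.complexConj L) 3 ((StdForm.antidiagonal 3).over L)) : Subgroup (quasiSplit (↥(maximalRealSubfield L)) L (IsCMField.complexConj L) 3).Adelic).subtype) hU hirr hD (hW₀U hw) ⟨j ⟨w, hw⟩, Representation.apply_mem_homRangeSum j ⟨w, hw⟩, rfl⟩ hw0
  exact ⟨W₀, hW₀K, hW₀U, hW₀fd, hirr₀, hUD⟩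

/-- **§A1 (reading) — `le_iSup_range_of_le_map_homRangeSum`**: `U ≤ (τ₀-part of r|_U).map U.subtype` READ INTERNALLY in p15's `hVτ` spelling — `U` is spanned by the ranges of the linear
`J : W₀ → (G(𝔸) → ℂ)` with `range J ≤ U` that are equivariant for `τ k := τ₀ ⟨ι k, _⟩` on `ι⁻¹K` (each `U.subtype ∘ T`, `T ∈ Hom_{K_∞}(τ₀, r|_U)`, is such a `J`; `Submodule.iSup_induction'`).
[cite: WallachRRG1, §1.4.7] -/
theorem le_iSup_range_of_le_map_homRangeSum [DecidablePred fun a : ↥(arch (↥(maximalRealSubfield L)) L (IsCMField.complexConj L) 3 ((StdForm.antidiagonal 3).over L)) => (adelicVal (↥(maximalRealSubfield L)) L (IsCMField.complexConj L) 3 ((StdForm.antidiagonal 3).over L)) ((archToAdelic (↥(maximalRealSubfield L)) L (IsCMField.complexConj L) 3 ((StdForm.antidiagonal 3).over L)) a) ∈ standardMaximalCompactGL 3 L]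
    (U : Submodule ℂ ((quasiSplit (↥(maximalRealSubfield L)) L (IsCMField.complexConj L) 3).Adelic → ℂ)) (hUinf : ∀ k : ↥(archMaximalCompact L), ∀ ψ ∈ U, ((rightTranslation (quasiSplit (↥(maximalRealSubfield L)) L (IsCMField.complexConj L) 3)).comp (archMaximalCompact L).subtype) k ψ ∈ U)
    (W₀ : Submodule ℂ ((quasiSplit (↥(maximalRealSubfield L)) L (IsCMField.complexConj L) 3).Adelic → ℂ)) (hW₀K : ∀ k : ↥(archMaximalCompact L), ∀ ψ ∈ W₀, ((rightTranslation (quasiSplit (↥(maximalRealSubfield L)) L (IsCMField.complexConj L) 3)).comp (archMaximalCompact L).subtype) k ψ ∈ W₀)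
    (hUD : U ≤ (Representation.homRangeSum (Subrepresentation.toRepresentation (⟨U, hUinf⟩ : Subrepresentation ((rightTranslation (quasiSplit (↥(maximalRealSubfield L)) L (IsCMField.complexConj L) 3)).comp (archMaximalCompact L).subtype))) (Subrepresentation.toRepresentation (⟨W₀, hW₀K⟩ : Subrepresentation ((rightTranslation (quasiSplit (↥(maximalRealSubfield L)) L (IsCMField.complexConj L) 3)).comp (archMaximalCompact L).subtype)))).map U.subtype) :
    U ≤ ⨆ (J : ↥W₀ →ₗ[ℂ] ((quasiSplit (↥(maximalRealSubfield L)) L (IsCMField.complexConj L) 3).Adelic → ℂ)) (_ : LinearMap.range J ≤ U ∧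
        ∀ k ∈ (((standardMaximalCompactGL 3 L).comap (adelicVal (↥(maximalRealSubfield L)) L (IsCMField.complexConj L) 3 ((StdForm.antidiagonal 3).over L)) : Subgroup (quasiSplit (↥(maximalRealSubfield L)) L (IsCMField.complexConj L) 3).Adelic)).comap (archToAdelic (↥(maximalRealSubfield L)) L (IsCMField.complexConj L) 3 ((StdForm.antidiagonal 3).over L)), ∀ (v : ↥W₀) (x : (quasiSplit (↥(maximalRealSubfield L)) L (IsCMField.complexConj L) 3).Adelic),
          J v (x * (archToAdelic (↥(maximalRealSubfield L)) L (IsCMField.complexConj L) 3 ((StdForm.antidiagonal 3).over L)) k) = J ((fun a : ↥(arch (↥(maximalRealSubfield L)) L (IsCMField.complexConj L) 3 ((StdForm.antidiagonal 3).over L)) => if h : (adelicVal (↥(maximalRealSubfield L)) L (IsCMField.complexConj L) 3 ((StdForm.antidiagonal 3).over L)) ((archToAdelic (↥(maximalRealSubfield L)) L (IsCMField.complexConj L) 3 ((StdForm.antidiagonal 3).over L)) a) ∈ standardMaximalCompactGL 3 L then (Subrepresentation.toRepresentation (⟨W₀, hW₀K⟩ : Subrepresentation ((rightTranslation (quasiSplit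 (↥(maximalRealSubfield L)) L (IsCMField.complexConj L) 3)).comp (archMaximalCompact L).subtype))) ⟨(archToAdelic (↥(maximalRealSubfield L)) L (IsCMField.complexConj L) 3 ((StdForm.antidiagonal 3).over L)) a, archToAdelic_mem_archMaximalCompact L a h⟩ else LinearMap.id) k v) x),
        LinearMap.range J := by
  intro ψ hψ
  obtain ⟨t, ht, rfl⟩ := hUD hψ
  clear hψ
  unfold Representation.homRangeSum at ht
  induction ht using Submodule.iSup_induction' with
  | mem T t ht' =>
    obtain ⟨v, rfl⟩ := ht'
    refine Submodule.mem_iSup_of_mem (U.subtype ∘ₗ T.toLinearMap) (Submodule.mem_iSup_of_mem ⟨?_, fun k hk v' x => ?_⟩ ⟨v, rfl⟩)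
    · rintro _ ⟨v', rfl⟩
      exact (T v').2
    · have hk' : (adelicVal (↥(maximalRealSubfield L)) L (IsCMField.complexConj L) 3 ((StdForm.antidiagonal 3).over L)) ((archToAdelic (↥(maximalRealSubfield L)) L (IsCMField.complexConj L) 3 ((StdForm.antidiagonal 3).over L)) k) ∈ standardMaximalCompactGL 3 L := hk
      dsimp only
      rw [dif_pos hk']
      show ((T v' : ↥U) : (quasiSplit (↥(maximalRealSubfield L)) L (IsCMField.complexConj L) 3).Adelic → ℂ) (x * (archToAdelic (↥(maximalRealSubfield L)) L (IsCMField.complexConj L) 3 ((StdForm.antidiagonal 3).over L)) k) = ((T ((Subrepresentation.toRepresentation (⟨W₀, hW₀K⟩ : Subrepresentation ((rightTranslation (quasiSplit (↥(maximalRealSubfield L)) L (IsCMField.complexConj L) 3)).comp (archMaximalCompact L).subtype))) ⟨(archToAdelic (↥(maximalRealSubfield L)) L (IsCMField.complexConj L) 3 ((StdForm.antidiagonal 3).over L)) k, archToAdelic_mem_archMaximalCompact L k hk'⟩ v') : ↥U) : (quasiSplit (↥(maximalRealSubfield L)) L (IsCMField.complexConj L) 3).Adelic → ℂ) x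
      rw [Representation.IntertwiningMap.isIntertwining (Subrepresentation.toRepresentation (⟨W₀, hW₀K⟩ : Subrepresentation ((rightTranslation (quasiSplit (↥(maximalRealSubfield L)) L (IsCMField.complexConj L) 3)).comp (archMaximalCompact L).subtype))) (Subrepresentation.toRepresentation (⟨U, hUinf⟩ : Subrepresentation ((rightTranslation (quasiSplit (↥(maximalRealSubfield L)) L (IsCMField.complexConj L) 3)).comp (archMaximalCompact L).subtype))) T ⟨(archToAdelic (↥(maximalRealSubfield L)) L (IsCMField.complexConj L) 3 ((StdForm.antidiagonal 3).over L)) k, archToAdelic_mem_archMaximalCompact L k hk'⟩ v']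
      rfl
  | zero =>
    rw [map_zero]
    exact Submodule.zero_mem _
  | add t₁ t₂ _ _ h₁ h₂ =>
    rw [map_add]
    exact Submodule.add_mem _ h₁ h₂

/-- **§A1 — `exists_isotypy_of_kMax_irreducible`: THE INTERNAL `W`-ISOTYPY OF A `K_max`-IRREDUCIBLE BLOCK** (the `hVτ` binder of ★ `chiEisenstein_meromorphic_exports_kfinite_of_ports[_of_coweightLine]`,
with `W := ↥W₀` and `τ k := τ₀ ⟨ι k, _⟩` on `ι⁻¹K`): core + reading. [cite: BrockerTomDieck1985, II (4.14)] [cite: WallachRRG1, §1.4.7, §3.3.1] -/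
theorem exists_isotypy_of_kMax_irreducible [DecidablePred fun a : ↥(arch (↥(maximalRealSubfield L)) L (IsCMField.complexConj L) 3 ((StdForm.antidiagonal 3).over L)) => (adelicVal (↥(maximalRealSubfield L)) L (IsCMField.complexConj L) 3 ((StdForm.antidiagonal 3).over L)) ((archToAdelic (↥(maximalRealSubfield L)) L (IsCMField.complexConj L) 3 ((StdForm.antidiagonal 3).over L)) a) ∈ standardMaximalCompactGL 3 L]
    (U : Submodule ℂ ((quasiSplit (↥(maximalRealSubfield L)) L (IsCMField.complexConj L) 3).Adelic → ℂ)) (hU : ∀ k : ↥((standardMaximalCompactGL 3 L).comap (adelicVal (↥(maximalRealSubfield L)) L (IsCMField.complexConj L) 3 ((StdForm.antidiagonal 3).over L)) : Subgroup (quasiSplit (↥(maximalRealSubfield L)) L (IsCMField.complexConj L) 3).Adelic), ∀ ψ ∈ U, ((rightTranslation (quasiSplit (↥(maximalRealSubfield L)) L (IsCMField.complexConj L) 3)).comp ((standardMaximalCompactGL 3 L).comap (adelicVal (↥(maximalRealSubfield L)) L (IsCMField.complexConj L) 3 ((StdForm.antidiagonal 3).over L)) : Subgroup (quasiSplit (↥(maximalRealSubfield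 L)) L (IsCMField.complexConj L) 3).Adelic).subtype) k ψ ∈ U) [hUfd : FiniteDimensional ℂ ↥U] (hirr : (Subrepresentation.toRepresentation (⟨U, hU⟩ : Subrepresentation ((rightTranslation (quasiSplit (↥(maximalRealSubfield L)) L (IsCMField.complexConj L) 3)).comp ((standardMaximalCompactGL 3 L).comap (adelicVal (↥(maximalRealSubfield L)) L (IsCMField.complexConj L) 3 ((StdForm.antidiagonal 3).over L)) : Subgroup (quasiSplit (↥(maximalRealSubfield L)) L (IsCMField.complexConj L) 3).Adelic).subtype))).IsIrreducible) :
    ∃ (W₀ : Submodule ℂ ((quasiSplit (↥(maximalRealSubfield L)) L (IsCMField.complexConj L) 3).Adelic → ℂ)) (hW₀K : ∀ k : ↥(archMaximalCompact L), ∀ ψ ∈ W₀, ((rightTranslation (quasiSplit (↥(maximalRealSubfield L)) L (IsCMField.complexConj L) 3)).comp (archMaximalCompact L).subtype) k ψ ∈ W₀),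
      W₀ ≤ U ∧ FiniteDimensional ℂ ↥W₀ ∧ (Subrepresentation.toRepresentation (⟨W₀, hW₀K⟩ : Subrepresentation ((rightTranslation (quasiSplit (↥(maximalRealSubfield L)) L (IsCMField.complexConj L) 3)).comp (archMaximalCompact L).subtype))).IsIrreducible ∧
      U ≤ ⨆ (J : ↥W₀ →ₗ[ℂ] ((quasiSplit (↥(maximalRealSubfield L)) L (IsCMField.complexConj L) 3).Adelic → ℂ)) (_ : LinearMap.range J ≤ U ∧
        ∀ k ∈ (((standardMaximalCompactGL 3 L).comap (adelicVal (↥(maximalRealSubfield L)) L (IsCMField.complexConj L) 3 ((StdForm.antidiagonal 3).over L)) : Subgroup (quasiSplit (↥(maximalRealSubfield L)) L (IsCMField.complexConj L) 3).Adelic)).comap (archToAdelic (↥(maximalRealSubfield L)) L (IsCMField.complexConj L) 3 ((StdForm.antidiagonal 3).over L)), ∀ (v : ↥W₀) (x : (quasiSplit (↥(maximalRealSubfield L)) L (IsCMField.complexConj L) 3).Adelic),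
          J v (x * (archToAdelic (↥(maximalRealSubfield L)) L (IsCMField.complexConj L) 3 ((StdForm.antidiagonal 3).over L)) k) = J ((fun a : ↥(arch (↥(maximalRealSubfield L)) L (IsCMField.complexConj L) 3 ((StdForm.antidiagonal 3).over L)) => if h : (adelicVal (↥(maximalRealSubfield L)) L (IsCMField.complexConj L) 3 ((StdForm.antidiagonal 3).over L)) ((archToAdelic (↥(maximalRealSubfield L)) L (IsCMField.complexConj L) 3 ((StdForm.antidiagonal 3).over L)) a) ∈ standardMaximalCompactGL 3 L then (Subrepresentation.toRepresentation (⟨W₀, hW₀K⟩ : Subrepresentation ((rightTranslation (quasiSplit (↥(maximalRealSubfield L)) L (IsCMField.complexConj L) 3)).comp (archMaximalCompact L).subtype))) ⟨(archToAdelic (↥(maximalRealSubfield L)) L (IsCMField.complexConj L) 3 ((StdForm.antidiagonal 3).over L)) a, archToAdelic_mem_archMaximalCompact L a h⟩ else LinearMap.id) k v) x),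
        LinearMap.range J := by
  have hUinf : ∀ k : ↥(archMaximalCompact L), ∀ ψ ∈ U, ((rightTranslation (quasiSplit (↥(maximalRealSubfield L)) L (IsCMField.complexConj L) 3)).comp (archMaximalCompact L).subtype) k ψ ∈ U := fun k ψ hψ =>
    hU ⟨(k : (quasiSplit (↥(maximalRealSubfield L)) L (IsCMField.complexConj L) 3).Adelic), archMaximalCompact_le_kMax L k.2⟩ ψ hψ
  obtain ⟨W₀, hW₀K, hW₀U, hW₀fd, hirr₀, hUD⟩ := exists_le_map_tauPart_of_kMax_irreducible L U hU hUinf hirr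
  exact ⟨W₀, hW₀K, hW₀U, hW₀fd, hirr₀, le_iSup_range_of_le_map_homRangeSum L U hUinf W₀ hW₀K hUD⟩

/-! ## §A2 The archimedean left law of the flat sections of a space of pair-sections (p15's `cB`, `hVB`, `χM`, `hcBM`) -/

/-- **`H(ι b · g) = H(ι b) · H(g)`** for `ι b ∈ B(𝔸)` (★ `borelHeight_borel_mul` at `g` and at `1`, ★ `borelHeight_one`). [cite: Garrett2018, §2.2] -/
theorem borelHeight_archBorel_mul {b : ↥(arch (↥(maximalRealSubfield L)) L (IsCMField.complexConj L) 3 ((StdForm.antidiagonal 3).over L))} (hb : (archToAdelic (↥(maximalRealSubfield L)) L (IsCMField.complexConj L) 3 ((StdForm.antidiagonal 3).over L)) b ∈ borelAdelic (↥(maximalRealSubfield L)) L (IsCMField.complexConj L) 3) (g : (quasiSplit (↥(maximalRealSubfield L)) L (IsCMField.complexConj L) 3).Adelic) :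
    borelHeight ((archToAdelic (↥(maximalRealSubfield L)) L (IsCMField.complexConj L) 3 ((StdForm.antidiagonal 3).over L)) b * g) = borelHeight ((archToAdelic (↥(maximalRealSubfield L)) L (IsCMField.complexConj L) 3 ((StdForm.antidiagonal 3).over L)) b) * borelHeight g := by
  have h1 := borelHeight_borel_mul hb (1 : (quasiSplit (↥(maximalRealSubfield L)) L (IsCMField.complexConj L) 3).Adelic)
  rw [mul_one, borelHeight_one, mul_one] at h1
  rw [borelHeight_borel_mul hb g, h1]

/-- **`H(ι m) = 1`** for `ι m ∈ K = K_∞·GL₃(𝒪̂)` (★ `borelHeight_mul_of_mem_comap_standardMaximalCompactGL` at `g = 1`, ★ `borelHeight_one`). [cite: Garrett2018, §2.2] -/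
theorem borelHeight_archToAdelic_eq_one {m : ↥(arch (↥(maximalRealSubfield L)) L (IsCMField.complexConj L) 3 ((StdForm.antidiagonal 3).over L))} (hm : (adelicVal (↥(maximalRealSubfield L)) L (IsCMField.complexConj L) 3 ((StdForm.antidiagonal 3).over L)) ((archToAdelic (↥(maximalRealSubfield L)) L (IsCMField.complexConj L) 3 ((StdForm.antidiagonal 3).over L)) m) ∈ standardMaximalCompactGL 3 L) : borelHeight ((archToAdelic (↥(maximalRealSubfield L)) L (IsCMField.complexConj L) 3 ((StdForm.antidiagonal 3).over L)) m) = 1 := by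
  rw [← one_mul ((archToAdelic (↥(maximalRealSubfield L)) L (IsCMField.complexConj L) 3 ((StdForm.antidiagonal 3).over L)) m), borelHeight_mul_of_mem_comap_standardMaximalCompactGL (Subgroup.mem_comap.2 hm), borelHeight_one]

variable {χ₁ : HeckeCharacter L} {χ₂ : ↥(TorusDict.torus (IsCMField.complexConj L)) →ₜ* ℂˣ}

/-- **THE ARCHIMEDEAN LEFT LAW OF A FLAT SECTION**: for a `(χ₁, χ₂)`-pair-section `φ`, `ι b ∈ B(𝔸)`, `a ∈ G_∞`, `x_f ∈ G(𝔸_f)`: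
`f_z^φ(ι(b a)·ι_f x_f) = (χ₁(b₀₀)·χ₂(b₁₁)·H(ι b)^z) · f_z^φ(ι a·ι_f x_f)` (pair-section law, `H` multiplicative under the Borel, `(st)^z = s^z t^z` for `s, t ≥ 0`). [cite: MoeglinWaldspurger1995, I.2.17, II.1.5] -/
theorem flatSectionU_archBorel_mul {φ : (quasiSplit (↥(maximalRealSubfield L)) L (IsCMField.complexConj L) 3).Adelic → ℂ} (hφ : IsChiSectionPair χ₁ χ₂ φ) (z : ℂ) {b : ↥(arch (↥(maximalRealSubfield L)) L (IsCMField.complexConj L) 3 ((StdForm.antidiagonal 3).over L))}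
    (hb : (archToAdelic (↥(maximalRealSubfield L)) L (IsCMField.complexConj L) 3 ((StdForm.antidiagonal 3).over L)) b ∈ borelAdelic (↥(maximalRealSubfield L)) L (IsCMField.complexConj L) 3) (a : ↥(arch (↥(maximalRealSubfield L)) L (IsCMField.complexConj L) 3 ((StdForm.antidiagonal 3).over L))) (xf : ↥(finAdelic (↥(maximalRealSubfield L)) L (IsCMField.complexConj L) 3 ((StdForm.antidiagonal 3).over L))) :
    flatSectionU φ z ((archToAdelic (↥(maximalRealSubfield L)) L (IsCMField.complexConj L) 3 ((StdForm.antidiagonal 3).over L)) (b * a) * (finAdelicToAdelic (↥(maximalRealSubfield L)) L (IsCMField.complexConj L) 3 ((StdForm.antidiagonal 3).over L)) xf) =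
      (((χ₁ (firstEntryUnit hb) : ℂˣ) : ℂ) * ((χ₂ (middleEntryUnitary hb) : ℂˣ) : ℂ) * (((borelHeight ((archToAdelic (↥(maximalRealSubfield L)) L (IsCMField.complexConj L) 3 ((StdForm.antidiagonal 3).over L)) b) : ℝ≥0) : ℝ) : ℂ) ^ z) * flatSectionU φ z ((archToAdelic (↥(maximalRealSubfield L)) L (IsCMField.complexConj L) 3 ((StdForm.antidiagonal 3).over L)) a * (finAdelicToAdelic (↥(maximalRealSubfield L)) L (IsCMField.complexConj L) 3 ((StdForm.antidiagonal 3).over L)) xf) := by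
  rw [flatSectionU_apply, flatSectionU_apply, map_mul, mul_assoc ((archToAdelic (↥(maximalRealSubfield L)) L (IsCMField.complexConj L) 3 ((StdForm.antidiagonal 3).over L)) b), hφ _ hb, borelHeight_archBorel_mul L hb, NNReal.coe_mul, Complex.ofReal_mul,
    Complex.mul_cpow_ofReal_nonneg (NNReal.coe_nonneg _) (NNReal.coe_nonneg _)]
  ring

open Classical in
/-- **`exists_archBorelLaw` — p15's `cB`∕`hVB`∕`χM`∕`hcBM` FOR ANY SPACE OF PAIR-SECTIONS**: there is ONE `cB : ℂ → G_∞ → ℂ` such that (i) every `(χ₁, χ₂)`-pair-section `φ ∈ V` obeys the left law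
`f_z^φ(ι(b a)·ι_f x_f) = cB z b · f_z^φ(ι a·ι_f x_f)` for `b ∈ ι⁻¹B(𝔸)`; (ii) on `M_∞ = ι⁻¹B(𝔸) ∩ ι⁻¹K` it is `z`-FREE (`cB z m = cB 0 m`, since `H(ι m) = 1`); (iii) there `cB 0 m = χ₁(m₀₀)·χ₂(m₁₁)` — the character of
`M_∞` the co-weight line is about.  (`cB z b := χ₁(b₀₀)χ₂(b₁₁)H(ι b)^z` on `ι⁻¹B(𝔸)`, `0` off it.) [cite: MoeglinWaldspurger1995, I.2.17] [cite: Garrett2018, §2.2] -/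
theorem exists_archBorelLaw {V : Submodule ℂ ((quasiSplit (↥(maximalRealSubfield L)) L (IsCMField.complexConj L) 3).Adelic → ℂ)} (hVχ : ∀ ψ ∈ V, IsChiSectionPair χ₁ χ₂ ψ) :
    ∃ cB : ℂ → ↥(arch (↥(maximalRealSubfield L)) L (IsCMField.complexConj L) 3 ((StdForm.antidiagonal 3).over L)) → ℂ,
      (∀ (z : ℂ), ∀ φ ∈ V, ∀ b ∈ (borelAdelic (↥(maximalRealSubfield L)) L (IsCMField.complexConj L) 3).comap (archToAdelic (↥(maximalRealSubfield L)) L (IsCMField.complexConj L) 3 ((StdForm.antidiagonal 3).over L)), ∀ (a : ↥(arch (↥(maximalRealSubfield L)) L (IsCMField.complexConj L) 3 ((StdForm.antidiagonal 3).over L))) (xf : ↥(finAdelic (↥(maximalRealSubfield L)) L (IsCMField.complexConj L) 3 ((StdForm.antidiagonal 3).over L))),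
        flatSectionU φ z ((archToAdelic (↥(maximalRealSubfield L)) L (IsCMField.complexConj L) 3 ((StdForm.antidiagonal 3).over L)) (b * a) * (finAdelicToAdelic (↥(maximalRealSubfield L)) L (IsCMField.complexConj L) 3 ((StdForm.antidiagonal 3).over L)) xf) = cB z b * flatSectionU φ z ((archToAdelic (↥(maximalRealSubfield L)) L (IsCMField.complexConj L) 3 ((StdForm.antidiagonal 3).over L)) a * (finAdelicToAdelic (↥(maximalRealSubfield L)) L (IsCMField.complexConj L) 3 ((StdForm.antidiagonal 3).over L)) xf)) ∧
      (∀ (z : ℂ), ∀ m ∈ (borelAdelic (↥(maximalRealSubfield L)) L (IsCMField.complexConj L) 3).comap (archToAdelic (↥(maximalRealSubfield L)) L (IsCMField.complexConj L) 3 ((StdForm.antidiagonal 3).over L)), m ∈ (((standardMaximalCompactGL 3 L).comap (adelicVal (↥(maximalRealSubfield L)) L (IsCMField.complexConj L) 3 ((StdForm.antidiagonal 3).over L)) : Subgroup (quasiSplit (↥(maximalRealSubfield L)) L (IsCMField.complexConj L) 3).Adelic)).comap (archToAdelic (↥(maximalRealSubfield L)) L (IsCMField.complexConj L) 3 ((StdForm.antidiagonal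 3).over L)) → cB z m = cB 0 m) ∧
      (∀ (m : ↥(arch (↥(maximalRealSubfield L)) L (IsCMField.complexConj L) 3 ((StdForm.antidiagonal 3).over L))) (hm : (archToAdelic (↥(maximalRealSubfield L)) L (IsCMField.complexConj L) 3 ((StdForm.antidiagonal 3).over L)) m ∈ borelAdelic (↥(maximalRealSubfield L)) L (IsCMField.complexConj L) 3), (adelicVal (↥(maximalRealSubfield L)) L (IsCMField.complexConj L) 3 ((StdForm.antidiagonal 3).over L)) ((archToAdelic (↥(maximalRealSubfield L)) L (IsCMField.complexConj L) 3 ((StdForm.antidiagonal 3).over L)) m) ∈ standardMaximalCompactGL 3 L →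
        cB 0 m = ((χ₁ (firstEntryUnit hm) : ℂˣ) : ℂ) * ((χ₂ (middleEntryUnitary hm) : ℂˣ) : ℂ)) := by
  refine ⟨fun z b => if hb : (archToAdelic (↥(maximalRealSubfield L)) L (IsCMField.complexConj L) 3 ((StdForm.antidiagonal 3).over L)) b ∈ borelAdelic (↥(maximalRealSubfield L)) L (IsCMField.complexConj L) 3 then
      ((χ₁ (firstEntryUnit hb) : ℂˣ) : ℂ) * ((χ₂ (middleEntryUnitary hb) : ℂˣ) : ℂ) * (((borelHeight ((archToAdelic (↥(maximalRealSubfield L)) L (IsCMField.complexConj L) 3 ((StdForm.antidiagonal 3).over L)) b) : ℝ≥0) : ℝ) : ℂ) ^ z else 0,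
    fun z φ hφ b hb a xf => ?_, fun z m hmB hmK => ?_, fun m hm hmK => ?_⟩
  · have hb' : (archToAdelic (↥(maximalRealSubfield L)) L (IsCMField.complexConj L) 3 ((StdForm.antidiagonal 3).over L)) b ∈ borelAdelic (↥(maximalRealSubfield L)) L (IsCMField.complexConj L) 3 := hb
    simp only [dif_pos hb']
    exact flatSectionU_archBorel_mul L (hVχ φ hφ) z hb' a xf
  · have hm' : (archToAdelic (↥(maximalRealSubfield L)) L (IsCMField.complexConj L) 3 ((StdForm.antidiagonal 3).over L)) m ∈ borelAdelic (↥(maximalRealSubfield L)) L (IsCMField.complexConj L) 3 := hmB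
    have hmK' : (adelicVal (↥(maximalRealSubfield L)) L (IsCMField.complexConj L) 3 ((StdForm.antidiagonal 3).over L)) ((archToAdelic (↥(maximalRealSubfield L)) L (IsCMField.complexConj L) 3 ((StdForm.antidiagonal 3).over L)) m) ∈ standardMaximalCompactGL 3 L := hmK
    simp only [dif_pos hm', borelHeight_archToAdelic_eq_one L hmK', NNReal.coe_one, Complex.ofReal_one, Complex.one_cpow]
  · simp only [dif_pos hm, borelHeight_archToAdelic_eq_one L hmK, NNReal.coe_one, Complex.ofReal_one, Complex.one_cpow, mul_one]

/-! ## §A3 The open-compact `GL₃(𝔸_f)`-level of a τ-level (p15's `U₀′`, `hU₀o`, `hU₀c`, `hU₀K`, `hVU`) -/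

/-- **`exists_GLlevel_of_isTauLevel`**: a τ-level `U₀ ≤ G(𝒪̂)_f` contains the unitary points of a PRINCIPAL LEVEL `K_f(n𝓞_L) = ofFinite⁻¹K(n𝓞_L) ≤ GL₃(𝔸_{L,f})`, `n ≠ 0` (★
`exists_finCongruenceLevel_span_le_of_isOpen`), which is open, compact and `≤ GL₃(𝒪̂_L)` (★ `AshSmithTheoryHeckeLevelProofs`). [cite: BorelJacquet1979, §4.1] -/
theorem exists_GLlevel_of_isTauLevel {U₀ : Subgroup ↥(finAdelic (↥(maximalRealSubfield L)) L (IsCMField.complexConj L) 3 ((StdForm.antidiagonal 3).over L))} (hU₀ : IsTauLevel L U₀) :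
    ∃ U₀' : Subgroup (GL (Fin 3) (FiniteAdeleRing (𝓞 L) L)),
      IsOpen (U₀' : Set (GL (Fin 3) (FiniteAdeleRing (𝓞 L) L))) ∧ IsCompact (U₀' : Set (GL (Fin 3) (FiniteAdeleRing (𝓞 L) L))) ∧ U₀' ≤ glFiniteIntegralLevel 3 L ∧
      ∀ b : ↥(finAdelic (↥(maximalRealSubfield L)) L (IsCMField.complexConj L) 3 ((StdForm.antidiagonal 3).over L)), (b : GL (Fin 3) (FiniteAdeleRing (𝓞 L) L)) ∈ U₀' → b ∈ U₀ := by
  obtain ⟨n, hn, hle⟩ := exists_finCongruenceLevel_span_le_of_isOpen (F := ↥(maximalRealSubfield L)) (E := L) (c := IsCMField.complexConj L) (N := 3) (J := ((StdForm.antidiagonal 3).over L)) hU₀.1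
  have h𝔫 : (Ideal.span {(n : 𝓞 L)} : Ideal (𝓞 L)) ≠ 0 := by
    rw [Ne, Ideal.zero_eq_bot, Ideal.span_singleton_eq_bot]
    exact_mod_cast hn
  exact ⟨(principalCongruenceLevel 3 L (Ideal.span {(n : 𝓞 L)})).comap (GLn.ofFinite 3 L), isOpen_comap_ofFinite_principalCongruenceLevel 3 L h𝔫,
    isCompact_comap_ofFinite_principalCongruenceLevel 3 L h𝔫, comap_ofFinite_principalCongruenceLevel_le 3 L _, fun b hb => hle ((mem_finCongruenceLevel_iff _ _ _ _ _ _ b).2 hb)⟩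

/-- **`hVU_of_le_tauLevel`** — p15's `hVU`: a space `V ≤ V(χ₁, χ₂; tauLevel U₀, 1)` is right-invariant under `ι_f(b)` for every `b ∈ G(𝔸_f)` whose matrix lies in a `GL₃(𝔸_f)`-subgroup `U₀′`
whose unitary points lie in `U₀`. [cite: BorelJacquet1979, §4.1] -/
theorem hVU_of_le_tauLevel {U₀ : Subgroup ↥(finAdelic (↥(maximalRealSubfield L)) L (IsCMField.complexConj L) 3 ((StdForm.antidiagonal 3).over L))} {V : Submodule ℂ ((quasiSplit (↥(maximalRealSubfield L)) L (IsCMField.complexConj L) 3).Adelic → ℂ)} (hVlev : V ≤ chiSectionSpacePair χ₁ χ₂ (tauLevel L U₀) ((1 : ↥(tauLevel L U₀) →* ℂ) : ↥(tauLevel L U₀) → ℂ))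
    {U₀' : Subgroup (GL (Fin 3) (FiniteAdeleRing (𝓞 L) L))} (hsub : ∀ b : ↥(finAdelic (↥(maximalRealSubfield L)) L (IsCMField.complexConj L) 3 ((StdForm.antidiagonal 3).over L)), (b : GL (Fin 3) (FiniteAdeleRing (𝓞 L) L)) ∈ U₀' → b ∈ U₀) :
    ∀ φ ∈ V, ∀ b : ↥(finAdelic (↥(maximalRealSubfield L)) L (IsCMField.complexConj L) 3 ((StdForm.antidiagonal 3).over L)), (b : GL (Fin 3) (FiniteAdeleRing (𝓞 L) L)) ∈ U₀' → ∀ y : (quasiSplit (↥(maximalRealSubfield L)) L (IsCMField.complexConj L) 3).Adelic, φ (y * (finAdelicToAdelic (↥(maximalRealSubfield L)) L (IsCMField.complexConj L) 3 ((StdForm.antidiagonal 3).over L)) b) = φ y := fun φ hφ b hb y => by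
  have h := apply_mul_of_mem (hVlev hφ) y ⟨_, finAdelicToAdelic_mem_tauLevel L (hsub b hb)⟩
  rwa [MonoidHom.one_apply, one_mul] at h

end Summit.HodgeConjecture.HodgeConjecture.R90.S8

end
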